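import Mathlib.RingTheory.Nakayama
import Mathlib.RingTheory.LocalRing.MaximalIdeal.Basic
import Mathlib.RingTheory.Ideal.Quotient.Operations
import HarnessLib

/-!
# [OURS · L1 W4.5(b) · EL♮(3)] THE SECTION-FRAME LIFT LEMMA — a system of parameters of `R/(ϖ)` lifts to a system of generators of the
# `ϖ`-saturated ideal `I` with `I + (ϖ) = 𝔪` (Nakayama)

Crux chain w45b (cell `res-hironaka`, slot W4.5(b)), working crux **EL♮** = stmt-ResolutionOfSingularities-20038, child **EL♮(3)** =
stmt-ResolutionOfSingularities-20148, route EquisingularLift, rung TOWER — after-care of res-L1-w45b-plan-1's RULING-5 (1)/(b)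
(2026-08-27T16:37:19Z; named to res-D-pv-051 in the DE-COLLISION ruling 17:03:18Z): the γ-cone base clause / `coneShadow_base` want «an
r.s.o.p. `c̄` of `𝒪_{F₁,x} = 𝒪_{X′,jx}/(ϖ)` lifts to a frame `c` of the section ideal `(ker s)_{jx}`», since `(ker s)_{jx} + (ϖ) = 𝔪` and
`𝒪/(ker s)_{jx} ≅ O` is `ϖ`-torsion-free. HONEST FRAMING: OURS; NOT a statement of any manuscript; AI-written, weaker than expert review.
No `sorry`; standard axioms. DEF-FREE; pure commutative algebra (Mathlib only). `--supports stmt-ResolutionOfSingularities-20148 --as helper`.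

* `map_mk_eq_map_mk_of_sup_span_eq` — `𝔪·(R/(ϖ)) = I·(R/(ϖ))` when `I + (ϖ) = 𝔪`;
* `le_span_sup_smul_of_torsionFree` — if `J ≤ I`, `J + (ϖ) ⊇ I` and `I` is `ϖ`-saturated then `I ≤ J + ϖ·I`;
* **`exists_frame_lift_of_torsionFree`** — THE LEMMA: `R` local, `I` finitely generated and `ϖ`-saturated (`ϖ r ∈ I ⇒ r ∈ I`) with
  `I + (ϖ) = 𝔪`; then every family `c̄ : Fin m → R/(ϖ)` generating `𝔪·(R/(ϖ))` lifts to `c : Fin m → R` with `c i ∈ I`,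
  `c i mod ϖ = c̄ i` and `(c) = I` (lift inside `I`; `I ≤ (c) + ϖ·I`; Nakayama, `ϖ ∈ 𝔪 = Jac`).

References: Nakayama's lemma [cite: Matsumura1987, Thm. 2.2]; Stacks 00DV [StacksProject]; Mathlib `Submodule.le_of_le_smul_of_le_jacobson_bot`.
-/

set_option linter.dupNamespace false -- mandated namespace `Summit.<Summit>.<Problem>` of this single-conjunct summit

namespace Summit.ResolutionOfSingularities.ResolutionOfSingularities.Cruxes.EquisingularLiftNat.Sections

open IsLocalRing

variable {R : Type*} [CommRing R]

/-- If `I + (ϖ) = 𝔞` then `𝔞` and `I` have the same image modulo `ϖ`. [folklore] -/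
theorem map_mk_eq_map_mk_of_sup_span_eq {I 𝔞 : Ideal R} {ϖ : R} (hsup : I ⊔ Ideal.span {ϖ} = 𝔞) :
    𝔞.map (Ideal.Quotient.mk (Ideal.span {ϖ})) = I.map (Ideal.Quotient.mk (Ideal.span {ϖ})) := by
  rw [← hsup, Ideal.map_sup]
  have h0 : (Ideal.span {ϖ}).map (Ideal.Quotient.mk (Ideal.span {ϖ})) = ⊥ := by
    rw [Ideal.map_eq_bot_iff_le_ker, Ideal.mk_ker]
  rw [h0, sup_bot_eq]

/-- **`I ≤ J + ϖ·I`** for `J ≤ I ≤ J + (ϖ)` when `I` is `ϖ`-saturated: write `r = j + ϖ s`; then `ϖ s = r − j ∈ I`, so `s ∈ I`.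
[folklore] -/
theorem le_span_sup_smul_of_torsionFree {I J : Ideal R} {ϖ : R} (hJI : J ≤ I) (hIJ : I ≤ J ⊔ Ideal.span {ϖ})
    (htf : ∀ r, ϖ * r ∈ I → r ∈ I) :
    (I : Submodule R R) ≤ J ⊔ Ideal.span {ϖ} • (I : Submodule R R) := by
  intro r hr
  obtain ⟨j, hj, p, hp, rfl⟩ := Submodule.mem_sup.mp (hIJ hr)
  obtain ⟨s, rfl⟩ := Ideal.mem_span_singleton'.mp hp
  have hs : s ∈ I := by
    apply htf
    have h : s * ϖ ∈ I := by
      have := I.sub_mem hr (hJI hj)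
      rwa [add_sub_cancel_left] at this
    rwa [mul_comm] at h
  refine Submodule.mem_sup.mpr ⟨j, hj, s * ϖ, ?_, rfl⟩
  rw [mul_comm]
  exact Submodule.smul_mem_smul (Ideal.mem_span_singleton_self ϖ) hs

/-- **THE SECTION-FRAME LIFT LEMMA.** Let `R` be a local ring, `I` a finitely generated ideal with `I + (ϖ) = 𝔪_R` which is
`ϖ`-saturated (`ϖ r ∈ I ⇒ r ∈ I`; e.g. `R/I` a domain not containing the class of `ϖ` … i.e. `R/I ≅ O` with `ϖ` a uniformizer). Then
every family `c̄ : Fin m → R/(ϖ)` generating the maximal ideal `𝔪_R·(R/(ϖ))` lifts to a family `c : Fin m → R` INSIDE `I` reducing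
to `c̄` and GENERATING `I`. For the tower: an r.s.o.p. of `𝒪_{F₁,x} = 𝒪_{X′,jx}/(ϖ)` lifts to a frame of the section ideal
`(ker s)_{jx}`. [cite: Matsumura1987, Thm. 2.2 (Nakayama)] [OURS · L1 W4.5b] RULING-5 (1)/(b) after-care; NOT a statement of the manuscript. -/
theorem exists_frame_lift_of_torsionFree [IsLocalRing R] {I : Ideal R} (hI : I.FG) {ϖ : R}
    (hsup : I ⊔ Ideal.span {ϖ} = maximalIdeal R) (htf : ∀ r, ϖ * r ∈ I → r ∈ I) {m : ℕ}
    (cb : Fin m → R ⧸ Ideal.span {ϖ})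
    (hcb : Ideal.span (Set.range cb) = (maximalIdeal R).map (Ideal.Quotient.mk (Ideal.span {ϖ}))) :
    ∃ c : Fin m → R, (∀ i, c i ∈ I) ∧ (∀ i, Ideal.Quotient.mk (Ideal.span {ϖ}) (c i) = cb i) ∧
      Ideal.span (Set.range c) = I := by
  classical
  have hmapI : (maximalIdeal R).map (Ideal.Quotient.mk (Ideal.span {ϖ})) = I.map (Ideal.Quotient.mk (Ideal.span {ϖ})) :=
    map_mk_eq_map_mk_of_sup_span_eq hsup
  -- lift each `c̄ i` inside `I`
  have hlift : ∀ i, ∃ r, r ∈ I ∧ Ideal.Quotient.mk (Ideal.span {ϖ}) r = cb i := fun i => by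
    have hi : cb i ∈ I.map (Ideal.Quotient.mk (Ideal.span {ϖ})) := by
      rw [← hmapI, ← hcb]
      exact Ideal.subset_span (Set.mem_range_self i)
    exact (Ideal.mem_map_iff_of_surjective _ Ideal.Quotient.mk_surjective).mp hi
  choose c hcI hc using hlift
  refine ⟨c, hcI, hc, ?_⟩
  have hJI : Ideal.span (Set.range c) ≤ I := Ideal.span_le.mpr (by rintro _ ⟨i, rfl⟩; exact hcI i)
  refine le_antisymm hJI ?_
  -- `I ≤ (c) + (ϖ)`: modulo `ϖ`, `I` and `(c)` have the same image
  have hmapJ : (Ideal.span (Set.range c)).map (Ideal.Quotient.mk (Ideal.span {ϖ})) = Ideal.span (Set.range cb) := by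
    have hcomp : (⇑(Ideal.Quotient.mk (Ideal.span {ϖ})) ∘ c) = cb := funext hc
    rw [Ideal.map_span, ← Set.range_comp, hcomp]
  have hIJ : I ≤ Ideal.span (Set.range c) ⊔ Ideal.span {ϖ} := by
    intro r hr
    have h1 : Ideal.Quotient.mk (Ideal.span {ϖ}) r ∈ (Ideal.span (Set.range c)).map (Ideal.Quotient.mk (Ideal.span {ϖ})) := by
      rw [hmapJ, hcb, hmapI]
      exact Ideal.mem_map_of_mem _ hr
    have h2 : r ∈ ((Ideal.span (Set.range c)).map (Ideal.Quotient.mk (Ideal.span {ϖ}))).comap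
        (Ideal.Quotient.mk (Ideal.span {ϖ})) := h1
    rwa [Ideal.comap_map_of_surjective _ Ideal.Quotient.mk_surjective, ← RingHom.ker_eq_comap_bot, Ideal.mk_ker] at h2
  -- Nakayama: `I ≤ (c) + ϖ·I`, `ϖ ∈ 𝔪 = Jac`
  have hϖ : Ideal.span {ϖ} ≤ (⊥ : Ideal R).jacobson := by
    refine le_trans ?_ (maximalIdeal_le_jacobson ⊥)
    rw [← hsup]; exact le_sup_right
  exact Submodule.le_of_le_smul_of_le_jacobson_bot hI hϖ (le_span_sup_smul_of_torsionFree hJI hIJ htf)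

end Summit.ResolutionOfSingularities.ResolutionOfSingularities.Cruxes.EquisingularLiftNat.Sections
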